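import Literature.AlgebraicGeometry.Resolution.CohenMacaulaySystemsOfParameters
import Literature.AlgebraicGeometry.Resolution.RegularLocalRingsQuotient
import Mathlib.RingTheory.Regular.Flat
import Mathlib.RingTheory.Flat.FaithfullyFlat.Algebra
import Mathlib.RingTheory.Nakayama
import Mathlib.RingTheory.Ideal.KrullsHeightTheorem
import HarnessLib

/-!
# The Cohen–Macaulay + Frobenius-closed stalk clause is invariant along 𝔪-adically bijective flat local maps —
# §T2a of `PFixTowerSig` (crux stmt-ResolutionOfSingularities-15315, chain w45a)

[OURS · L1 W4.5a · res-D-pv-019 AS res-L1-w45a-stub-7] Support file (`--supports stmt-ResolutionOfSingularities-15315 --as helper`)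
for the crux `FrobeniusLadder.FInjectiveMacaulayfication`; NOT a statement of any manuscript; AI-written, weaker than expert review.
Statement = §T2a `stub_fiClause_adicTransfer` of the strategist's sketch file `L/res-L1-w45a-strat-1/PFixTowerSig.lean` r2 sha16
b235fde4a11e66a6 (l.130–136) VERBATIM with the `stub_` prefix dropped (ruling R12.9 (d) of res-L1-w45a-plan-1, HOME/STATUS
2026-08-27T08:01:39Z: «§T2a + 5i ASSIGNED to stub-7»).

THE THEOREM (`fiClause_adicTransfer`). Let `A → B` be a flat local homomorphism of Noetherian local rings with `𝔪_A B = 𝔪_B` and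
`A → B/𝔪_B^m` surjective for every `m` (e.g. completion, henselisation, the local ring of an étale neighbourhood with the same residue
field). Then the crux's per-stalk clause WITHOUT the domain conjunct — «for every `d = dim` and every `s : Fin d →` ring whose ideal
has maximal radical: `s` is weakly regular and `(s)` is Frobenius closed in the inline sense
`(∃ e, y^(p^e) ∈ ((s)^[p^e])) → y ∈ (s)`» — holds for `A` iff it holds for `B`. No characteristic hypothesis is needed (`p` is any
natural number; the proof never divides and never uses the binomial theorem).

PROOF. `B` is faithfully flat over `A` (Mathlib `Module.FaithfullyFlat.of_flat_of_isLocalHom`), so `IB ∩ A = I` for every ideal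
(`Ideal.comap_map_eq_self_of_faithfullyFlat`) and `𝔪_B^m = 𝔪_A^m B`. APPROXIMATION: every `b ∈ B` is `φ(a) + r` with `r ∈ 𝔪_B^M`, `M`
arbitrary. Consequences: (1) for an `𝔪_A`-primary `I` and every `q`, `(IB)^[q] = I^[q] B` (`z = φ(a) + r`, `a ∈ I`, and
`z^q − φ(a)^q ∈ (r) ⊆ 𝔪_B^M ⊆ I^[q] B` for `M` large, since `I^[q] ⊇ 𝔪_A^M`); (2) NAKAYAMA: every system of parameters `s′` of `B`
generates the same ideal as the image of a `d`-tuple `a` of `A` (approximate `s′ᵢ` modulo `𝔪_B · (s′)`), and `(a)` is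
`𝔪_A`-primary; with Krull's height theorem this gives `dim A = dim B` (both `≤` the other). COHEN–MACAULAY PART: by the tree's
dictionary `cmClause_iff_exists_isRegular` (Matsumura 17.4) the weak regularity of all systems of parameters is the existence of one
regular sequence in `𝔪` of length `dim`; it ASCENDS along the faithfully flat `φ` (Mathlib `IsRegular.of_faithfullyFlat`) and the
weak regularity of a given `s` DESCENDS (`isWeaklyRegular_of_faithfullyFlat`, proved here: faithfully flat base change reflects
injectivity, Mathlib `Module.FaithfullyFlat.lTensor_injective_iff_injective`). FROBENIUS PART: descent by `φ(y)^q ∈ I^[q]B = (IB)^[q]`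
and `IB ∩ A = I`; ascent by approximating `y′ = φ(y) + r` with `r ∈ 𝔪_B^M ⊆ I^[q]B ∩ IB`. Zero named facts, no `sorry`.
-/

-- single-problem summit: the doubled namespace component is forced
set_option linter.dupNamespace false

noncomputable section

namespace Summit.ResolutionOfSingularities.ResolutionOfSingularities.Theorems.FInjectiveMacaulayfication.FiClauseAdicTransfer

open IsLocalRing RingTheory.Sequence Literature.AlgebraicGeometry.Resolution Literature.RingTheory.TightClosure
open scoped TensorProduct

/-! ## Faithfully flat descent of (weakly) regular elements and sequences -/

/-- Faithfully flat base change REFLECTS regular elements: if `N = S ⊗_R M` along `f` with `S` faithfully flat over `R` and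
`φ(x)` is `N`-regular, then `x` is `M`-regular (converse of Mathlib `IsSMulRegular.of_flat_of_isBaseChange`). [folklore] -/
theorem isSMulRegular_of_faithfullyFlat_of_isBaseChange {R S M N : Type*} [CommRing R] [CommRing S] [Algebra R S]
    [AddCommGroup M] [Module R M] [AddCommGroup N] [Module R N] [Module S N] [IsScalarTower R S N]
    [Module.FaithfullyFlat R S] {f : M →ₗ[R] N} (hf : IsBaseChange S f) {x : R}
    (reg : IsSMulRegular N (algebraMap R S x)) : IsSMulRegular M x := by
  have key : ∀ z : S ⊗[R] M,
      hf.equiv ((LinearMap.lsmul R M x).lTensor S z) = algebraMap R S x • hf.equiv z := by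
    intro z
    induction z using TensorProduct.induction_on with
    | zero => simp
    | tmul s m =>
        rw [LinearMap.lTensor_tmul, LinearMap.lsmul_apply, IsBaseChange.equiv_tmul, IsBaseChange.equiv_tmul,
          map_smul, algebraMap_smul, smul_comm]
    | add a b ha hb => rw [map_add, map_add, ha, hb, map_add, smul_add]
  have hinj : Function.Injective ((LinearMap.lsmul R M x).lTensor S) := by
    intro z₁ z₂ h
    have h' := congrArg hf.equiv h
    rw [key, key] at h'
    exact hf.equiv.injective (reg h')
  have h := (Module.FaithfullyFlat.lTensor_injective_iff_injective (R := R) (M := S)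
    (LinearMap.lsmul R M x)).mp hinj
  exact fun a b hab => h hab

/-- Faithfully flat base change REFLECTS weakly regular sequences: if the image of `rs` in `S` is weakly regular on
`N = S ⊗_R M`, then `rs` is weakly regular on `M` (converse of Mathlib `IsWeaklyRegular.of_flat_of_isBaseChange`). [folklore] -/
theorem isWeaklyRegular_of_faithfullyFlat_of_isBaseChange {R S M N : Type*} [CommRing R] [CommRing S] [Algebra R S]
    [AddCommGroup M] [Module R M] [AddCommGroup N] [Module R N] [Module S N] [IsScalarTower R S N]
    [Module.FaithfullyFlat R S] {f : M →ₗ[R] N} (hf : IsBaseChange S f)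
    {rs : List R} (reg : IsWeaklyRegular N (rs.map (algebraMap R S))) : IsWeaklyRegular M rs := by
  induction rs generalizing M N with
  | nil => exact IsWeaklyRegular.nil R M
  | cons x _ ih =>
    simp only [List.map_cons, isWeaklyRegular_cons_iff] at reg ⊢
    have e := (QuotSMulTop.algebraMapTensorEquivTensorQuotSMulTop x M S).symm ≪≫ₗ
      QuotSMulTop.congr ((algebraMap R S) x) hf.equiv
    have hg : IsBaseChange S <|
        e.toLinearMap.restrictScalars R ∘ₗ TensorProduct.mk R S (QuotSMulTop x M) 1 :=
      IsBaseChange.of_equiv e (fun _ ↦ by simp)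
    exact ⟨isSMulRegular_of_faithfullyFlat_of_isBaseChange hf reg.1, ih hg reg.2⟩

/-- Faithfully flat ring maps REFLECT weakly regular sequences: if `φ(rs)` is weakly regular on the faithfully flat `R`-algebra
`S`, then `rs` is weakly regular on `R`. [folklore] -/
theorem isWeaklyRegular_of_faithfullyFlat {R S : Type*} [CommRing R] [CommRing S] [Algebra R S] [Module.FaithfullyFlat R S]
    {rs : List R} (reg : IsWeaklyRegular S (rs.map (algebraMap R S))) : IsWeaklyRegular R rs :=
  isWeaklyRegular_of_faithfullyFlat_of_isBaseChange (IsBaseChange.linearMap R S) reg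

/-! ## Krull: the dimension of a local ring is at most the length of any tuple with maximal radical -/

/-- If `d` elements of a Noetherian local ring generate an ideal with radical `𝔪`, then `dim R ≤ d` (Krull's height theorem,
Mathlib `Ideal.height_le_card_of_mem_minimalPrimes_span`). [folklore] -/
theorem ringKrullDim_le_of_radical_span_eq {R : Type*} [CommRing R] [IsNoetherianRing R] [IsLocalRing R] {d : ℕ}
    (s : Fin d → R) (hs : (Ideal.span (Set.range s)).radical = maximalIdeal R) : ringKrullDim R ≤ d := by
  have hmin : maximalIdeal R ∈ (Ideal.span (Set.range s)).minimalPrimes := by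
    rw [← Ideal.radical_minimalPrimes, hs, Ideal.minimalPrimes_eq_subsingleton_self]
    exact Set.mem_singleton _
  have h := Ideal.height_le_card_of_mem_minimalPrimes_span (Set.finite_range s) hmin
  have hcard : (Set.range s).ncard ≤ d := by
    have h1 := Set.ncard_image_le (f := s) (s := Set.univ) (Set.toFinite _)
    rwa [Set.image_univ, Set.ncard_univ, Nat.card_eq_fintype_card, Fintype.card_fin] at h1
  rw [← IsLocalRing.maximalIdeal_height_eq_ringKrullDim]
  have h2 : (maximalIdeal R).height ≤ (d : ℕ∞) := h.trans (by exact_mod_cast hcard)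
  exact_mod_cast h2

/-! ## §T2a -/

/-- **§T2a — THE COHEN–MACAULAY + FROBENIUS-CLOSED CLAUSE IS INVARIANT ALONG 𝔪-ADICALLY BIJECTIVE FLAT LOCAL MAPS**
(`PFixTowerSig` r2 b235fde4a11e66a6 `stub_fiClause_adicTransfer`, verbatim): for a flat local homomorphism `A → B` of Noetherian
local rings with `𝔪_A B = 𝔪_B` and `A → B/𝔪_B^m` surjective for all `m`, the per-stalk clause (every system of parameters weakly
regular and generating a Frobenius-closed ideal, inline) holds for `A` iff it holds for `B`. Pure commutative algebra; any `p : ℕ`.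
[folklore] -/
theorem fiClause_adicTransfer : ∀ (p : ℕ) (A B : Type) [CommRing A] [IsLocalRing A] [IsNoetherianRing A]
    [CommRing B] [IsLocalRing B] [IsNoetherianRing B] [Algebra A B] [IsLocalHom (algebraMap A B)] [Module.Flat A B],
    (IsLocalRing.maximalIdeal A).map (algebraMap A B) = IsLocalRing.maximalIdeal B →
    (∀ m : ℕ, Function.Surjective (fun a : A => Ideal.Quotient.mk (IsLocalRing.maximalIdeal B ^ m) (algebraMap A B a))) →
    ((∀ d : ℕ, ringKrullDim (A) = d → ∀ s : Fin d → A, (Ideal.span (Set.range s)).radical.IsMaximal → RingTheory.Sequence.IsWeaklyRegular (A) (List.ofFn s) ∧ ∀ y : A, (∃ e : ℕ, y ^ p ^ e ∈ Ideal.span ((fun z : A => z ^ p ^ e) '' (Ideal.span (Set.range s) : Set (A)))) → y ∈ Ideal.span (Set.range s)) ↔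
     (∀ d : ℕ, ringKrullDim (B) = d → ∀ s : Fin d → B, (Ideal.span (Set.range s)).radical.IsMaximal → RingTheory.Sequence.IsWeaklyRegular (B) (List.ofFn s) ∧ ∀ y : B, (∃ e : ℕ, y ^ p ^ e ∈ Ideal.span ((fun z : B => z ^ p ^ e) '' (Ideal.span (Set.range s) : Set (B)))) → y ∈ Ideal.span (Set.range s))) := by
  intro p A B _ _ _ _ _ _ _ _ _ h𝔪 hsurj
  haveI : Module.FaithfullyFlat A B := Module.FaithfullyFlat.of_flat_of_isLocalHom
  -- bookkeeping along `φ = algebraMap A B`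
  have hcm : ∀ I : Ideal A, (I.map (algebraMap A B)).comap (algebraMap A B) = I := fun I =>
    Ideal.comap_map_eq_self_of_faithfullyFlat I
  have hpow : ∀ m : ℕ, (maximalIdeal A ^ m).map (algebraMap A B) = maximalIdeal B ^ m := fun m => by
    rw [Ideal.map_pow, h𝔪]
  have happrox : ∀ (m : ℕ) (b : B), ∃ a : A, b - algebraMap A B a ∈ maximalIdeal B ^ m := fun m b => by
    obtain ⟨a, ha⟩ := hsurj m (Ideal.Quotient.mk _ b)
    exact ⟨a, Ideal.Quotient.eq.mp ha.symm⟩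
  have hprimA : ∀ I : Ideal A, maximalIdeal A ≤ I.radical → ∃ m : ℕ, maximalIdeal A ^ m ≤ I := fun I hI =>
    Ideal.exists_pow_le_of_le_radical_of_fg hI (IsNoetherian.noetherian _)
  have hprimB : ∀ J : Ideal B, maximalIdeal B ≤ J.radical → ∃ m : ℕ, maximalIdeal B ^ m ≤ J := fun J hJ =>
    Ideal.exists_pow_le_of_le_radical_of_fg hJ (IsNoetherian.noetherian _)
  -- radicals of extended and contracted ideals
  have hradext : ∀ I : Ideal A, I.radical = maximalIdeal A → (I.map (algebraMap A B)).radical = maximalIdeal B := by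
    intro I hI
    obtain ⟨m, hm⟩ := hprimA I hI.ge
    apply le_antisymm
    · refine (Ideal.IsPrime.radical_le_iff inferInstance).mpr ?_
      rw [← h𝔪]
      exact Ideal.map_mono (hI ▸ Ideal.le_radical : I ≤ maximalIdeal A)
    · intro x hx
      exact ⟨m, (hpow m ▸ Ideal.map_mono hm : maximalIdeal B ^ m ≤ _) (Ideal.pow_mem_pow hx m)⟩
  have hradcomap : ∀ J : Ideal B, J.radical = maximalIdeal B →
      (J.comap (algebraMap A B)).radical = maximalIdeal A := by
    intro J hJ
    rw [← Ideal.comap_radical, hJ, ← h𝔪, hcm]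
  -- (1) the Frobenius-power identity `(IB)^[q] = I^[q] B` for `𝔪_A`-primary `I`
  have hfrob : ∀ (q : ℕ) (I : Ideal A), I.radical = maximalIdeal A →
      Ideal.span ((fun z : B => z ^ q) '' ((I.map (algebraMap A B) : Ideal B) : Set B)) =
        (Ideal.span ((fun z : A => z ^ q) '' (I : Set A))).map (algebraMap A B) := by
    intro q I hI
    apply le_antisymm
    · have hle : maximalIdeal A ≤ (Ideal.span ((fun z : A => z ^ q) '' (I : Set A))).radical := by
        intro x hx
        have hxI : x ∈ I.radical := hI.symm ▸ hx
        obtain ⟨n, hn⟩ := hxI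
        exact ⟨n * q, by rw [pow_mul]; exact Ideal.subset_span ⟨x ^ n, hn, rfl⟩⟩
      obtain ⟨M₁, hM₁⟩ := hprimA _ hle
      obtain ⟨M₂, hM₂⟩ := hprimA I hI.ge
      have hB₁ : maximalIdeal B ^ (M₁ + M₂) ≤
          (Ideal.span ((fun z : A => z ^ q) '' (I : Set A))).map (algebraMap A B) :=
        (Ideal.pow_le_pow_right (Nat.le_add_right M₁ M₂)).trans (hpow M₁ ▸ Ideal.map_mono hM₁)
      have hB₂ : maximalIdeal B ^ (M₁ + M₂) ≤ I.map (algebraMap A B) :=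
        (Ideal.pow_le_pow_right (Nat.le_add_left M₂ M₁)).trans (hpow M₂ ▸ Ideal.map_mono hM₂)
      rw [Ideal.span_le]
      rintro _ ⟨z, hz, rfl⟩
      obtain ⟨a, ha⟩ := happrox (M₁ + M₂) z
      have haI : a ∈ I := by
        have hφa : algebraMap A B a ∈ I.map (algebraMap A B) := by
          have : algebraMap A B a = z - (z - algebraMap A B a) := by ring
          rw [this]
          exact sub_mem hz (hB₂ ha)
        have := Ideal.mem_comap.mpr hφa
        rwa [hcm] at this
      have hzq : z ^ q - algebraMap A B (a ^ q) ∈ maximalIdeal B ^ (M₁ + M₂) := by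
        rw [map_pow]
        obtain ⟨w, hw⟩ := sub_dvd_pow_sub_pow z (algebraMap A B a) q
        rw [hw]
        exact Ideal.mul_mem_right w _ ha
      have : z ^ q = algebraMap A B (a ^ q) + (z ^ q - algebraMap A B (a ^ q)) := by ring
      change z ^ q ∈ (Ideal.span ((fun z : A => z ^ q) '' (I : Set A))).map (algebraMap A B)
      rw [this]
      exact add_mem (Ideal.mem_map_of_mem _ (Ideal.subset_span ⟨a, haI, rfl⟩)) (hB₁ hzq)
    · rw [Ideal.map_le_iff_le_comap, Ideal.span_le]
      rintro _ ⟨x, hx, rfl⟩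
      rw [SetLike.mem_coe, Ideal.mem_comap, map_pow]
      exact Ideal.subset_span ⟨algebraMap A B x, Ideal.mem_map_of_mem _ hx, rfl⟩
  -- (2) Nakayama: a system of parameters of `B` generates the extension of a `d`-tuple of `A`
  have hgen : ∀ {d : ℕ} (s' : Fin d → B), (Ideal.span (Set.range s')).radical = maximalIdeal B →
      ∃ a : Fin d → A, (Ideal.span (Set.range a)).map (algebraMap A B) = Ideal.span (Set.range s') := by
    intro d s' hs'
    obtain ⟨m, hm⟩ := hprimB _ hs'.ge
    choose a ha using fun i => happrox (m + 1) (s' i)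
    have hsm : maximalIdeal B ^ (m + 1) ≤ maximalIdeal B • Ideal.span (Set.range s') := by
      rw [pow_succ', Ideal.smul_eq_mul]
      exact Ideal.mul_mono_right hm
    refine ⟨a, le_antisymm ?_ ?_⟩
    · rw [Ideal.map_le_iff_le_comap, Ideal.span_le]
      rintro _ ⟨i, rfl⟩
      rw [SetLike.mem_coe, Ideal.mem_comap]
      have : algebraMap A B (a i) = s' i - (s' i - algebraMap A B (a i)) := by ring
      rw [this]
      exact sub_mem (Ideal.subset_span ⟨i, rfl⟩) (((Ideal.pow_le_pow_right (Nat.le_succ m)).trans hm) (ha i))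
    · apply Submodule.le_of_le_smul_of_le_jacobson_bot (I := maximalIdeal B)
        (N := (Ideal.span (Set.range a)).map (algebraMap A B)) (IsNoetherian.noetherian _)
        (IsLocalRing.maximalIdeal_le_jacobson _)
      rw [Ideal.span_le]
      rintro _ ⟨i, rfl⟩
      have h1 : algebraMap A B (a i) ∈ (Ideal.span (Set.range a)).map (algebraMap A B) :=
        Ideal.mem_map_of_mem _ (Ideal.subset_span ⟨i, rfl⟩)
      have h2 : s' i - algebraMap A B (a i) ∈ maximalIdeal B • Ideal.span (Set.range s') := hsm (ha i)
      have : s' i = algebraMap A B (a i) + (s' i - algebraMap A B (a i)) := by ring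
      rw [SetLike.mem_coe, this]
      exact Submodule.add_mem_sup h1 h2
  -- (3) `dim A = dim B`
  obtain ⟨dA, hdA⟩ := exists_nat_cast_eq_ringKrullDim (R := A)
  obtain ⟨dB, hdB⟩ := exists_nat_cast_eq_ringKrullDim (R := B)
  have hBA : dB ≤ dA := by
    obtain ⟨s, hs⟩ := exists_isSystemOfParameters (R := A) hdA
    have ht : Ideal.span (Set.range fun i => algebraMap A B (s i)) = (Ideal.span (Set.range s)).map (algebraMap A B) := by
      rw [Ideal.map_span, ← Set.range_comp]
      rfl
    have h := ringKrullDim_le_of_radical_span_eq (fun i => algebraMap A B (s i)) (by rw [ht]; exact hradext _ hs.2)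
    rw [hdB] at h
    exact_mod_cast h
  have hAB : dA ≤ dB := by
    obtain ⟨s', hs'⟩ := exists_isSystemOfParameters (R := B) hdB
    obtain ⟨a, ha⟩ := hgen s' hs'.2
    have hrada : (Ideal.span (Set.range a)).radical = maximalIdeal A := by
      have := hradcomap _ hs'.2
      rwa [← ha, hcm] at this
    have h := ringKrullDim_le_of_radical_span_eq a hrada
    rw [hdA] at h
    exact_mod_cast h
  have hdAB : dA = dB := le_antisymm hAB hBA
  -- (4) the transfer
  constructor
  · intro hA d hd s' hs'
    have hddB : dB = d := by
      have := hdB.symm.trans hd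
      exact_mod_cast this
    have hd' : ringKrullDim A = d := by rw [hdA, hdAB, hddB]
    have hrad' : (Ideal.span (Set.range s')).radical = maximalIdeal B := eq_maximalIdeal hs'
    obtain ⟨a, ha⟩ := hgen s' hrad'
    have hrada : (Ideal.span (Set.range a)).radical = maximalIdeal A := by
      have := hradcomap _ hrad'
      rwa [← ha, hcm] at this
    obtain ⟨-, hFCa⟩ := hA d hd' a (hrada ▸ maximalIdeal.isMaximal A)
    refine ⟨?_, ?_⟩
    · -- weak regularity of `s'`: `A` is Cohen–Macaulay, hence so is `B`
      obtain ⟨rs, hrs, hmem, hlen⟩ := exists_isRegular_of_cmClause (S := A) fun d hd s hs => (hA d hd s hs).1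
      have hrsB : IsRegular B (rs.map (algebraMap A B)) := hrs.of_faithfullyFlat
      have hmemB : ∀ r ∈ rs.map (algebraMap A B), r ∈ maximalIdeal B := by
        intro r hr
        obtain ⟨r₀, hr₀, rfl⟩ := List.mem_map.mp hr
        rw [← h𝔪]
        exact Ideal.mem_map_of_mem _ (hmem r₀ hr₀)
      have hlenB : ((rs.map (algebraMap A B)).length : WithBot ℕ∞) = ringKrullDim B := by
        rw [List.length_map, hlen, hdA, hdB, hdAB]
      exact cmClause_of_exists_isRegular ⟨rs.map (algebraMap A B), hrsB, hmemB, hlenB⟩ d hd s' hs'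
    · -- Frobenius-closedness of `(s') = (a) B`
      rintro y' ⟨e, he⟩
      rw [← ha, hfrob (p ^ e) _ hrada] at he
      have hle : maximalIdeal A ≤ (Ideal.span ((fun z : A => z ^ p ^ e) '' (Ideal.span (Set.range a) : Set A))).radical := by
        intro x hx
        have hxI : x ∈ (Ideal.span (Set.range a)).radical := hrada.symm ▸ hx
        obtain ⟨n, hn⟩ := hxI
        exact ⟨n * p ^ e, by rw [pow_mul]; exact Ideal.subset_span ⟨x ^ n, hn, rfl⟩⟩
      obtain ⟨M₁, hM₁⟩ := hprimA _ hle
      obtain ⟨M₂, hM₂⟩ := hprimA _ hrada.ge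
      obtain ⟨α, hα⟩ := happrox (M₁ + M₂) y'
      have hB₁ : maximalIdeal B ^ (M₁ + M₂) ≤
          (Ideal.span ((fun z : A => z ^ p ^ e) '' (Ideal.span (Set.range a) : Set A))).map (algebraMap A B) :=
        (Ideal.pow_le_pow_right (Nat.le_add_right M₁ M₂)).trans (hpow M₁ ▸ Ideal.map_mono hM₁)
      have hB₂ : maximalIdeal B ^ (M₁ + M₂) ≤ (Ideal.span (Set.range a)).map (algebraMap A B) :=
        (Ideal.pow_le_pow_right (Nat.le_add_left M₂ M₁)).trans (hpow M₂ ▸ Ideal.map_mono hM₂)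
      have h1 : algebraMap A B (α ^ p ^ e) ∈
          (Ideal.span ((fun z : A => z ^ p ^ e) '' (Ideal.span (Set.range a) : Set A))).map (algebraMap A B) := by
        have hq : y' ^ p ^ e - algebraMap A B (α ^ p ^ e) ∈ maximalIdeal B ^ (M₁ + M₂) := by
          rw [map_pow]
          obtain ⟨w, hw⟩ := sub_dvd_pow_sub_pow y' (algebraMap A B α) (p ^ e)
          rw [hw]
          exact Ideal.mul_mem_right w _ hα
        have : algebraMap A B (α ^ p ^ e) = y' ^ p ^ e - (y' ^ p ^ e - algebraMap A B (α ^ p ^ e)) := by ring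
        rw [this]
        exact sub_mem he (hB₁ hq)
      have h2 : α ^ p ^ e ∈ Ideal.span ((fun z : A => z ^ p ^ e) '' (Ideal.span (Set.range a) : Set A)) := by
        have := Ideal.mem_comap.mpr h1
        rwa [hcm] at this
      have h3 : α ∈ Ideal.span (Set.range a) := hFCa α ⟨e, h2⟩
      have h4 : algebraMap A B α ∈ (Ideal.span (Set.range a)).map (algebraMap A B) := Ideal.mem_map_of_mem _ h3
      have h5 : y' - algebraMap A B α ∈ (Ideal.span (Set.range a)).map (algebraMap A B) := hB₂ hα
      have : y' = algebraMap A B α + (y' - algebraMap A B α) := by ring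
      rw [this, ← ha]
      exact add_mem h4 h5
  · intro hB d hd s hs
    have hddA : dA = d := by
      have := hdA.symm.trans hd
      exact_mod_cast this
    have hd' : ringKrullDim B = d := by rw [hdB, ← hdAB, hddA]
    have hrads : (Ideal.span (Set.range s)).radical = maximalIdeal A := eq_maximalIdeal hs
    have ht : Ideal.span (Set.range fun i => algebraMap A B (s i)) = (Ideal.span (Set.range s)).map (algebraMap A B) := by
      rw [Ideal.map_span, ← Set.range_comp]
      rfl
    have hradt : (Ideal.span (Set.range fun i => algebraMap A B (s i))).radical = maximalIdeal B := by
      rw [ht]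
      exact hradext _ hrads
    obtain ⟨hWRt, hFCt⟩ := hB d hd' (fun i => algebraMap A B (s i)) (hradt ▸ maximalIdeal.isMaximal B)
    refine ⟨?_, ?_⟩
    · -- weak regularity descends along the faithfully flat `φ`
      have : IsWeaklyRegular B ((List.ofFn s).map (algebraMap A B)) := by
        rw [List.map_ofFn]
        exact hWRt
      exact isWeaklyRegular_of_faithfullyFlat this
    · rintro y ⟨e, he⟩
      have h1 : algebraMap A B y ^ p ^ e ∈
          Ideal.span ((fun z : B => z ^ p ^ e) '' (Ideal.span (Set.range fun i => algebraMap A B (s i)) : Set B)) := by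
        rw [ht, hfrob (p ^ e) _ hrads, ← map_pow]
        exact Ideal.mem_map_of_mem _ he
      have h2 := hFCt (algebraMap A B y) ⟨e, h1⟩
      rw [ht] at h2
      have := Ideal.mem_comap.mpr h2
      rwa [hcm] at this

end Summit.ResolutionOfSingularities.ResolutionOfSingularities.Theorems.FInjectiveMacaulayfication.FiClauseAdicTransfer

end
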